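import Literature.NumberTheory.Automorphic.Liu2021.AppendixC.HeckeTranslates
import Literature.NumberTheory.DiophantineGeometry.AVIsogenyTate
import HarnessLib

/-!
# The Albanese trace and the Hecke translates on geometric difference points `α(x, y)`
# ([Liu2021] Def. 2.3 «`Alb_u ∘ α_Y = α_X ∘ ∇u`», §4.2 l. 2066–2074; [Lang1983AbelianVarieties] VIII §6 Thm. 13)

Topic `Literature/NumberTheory/Automorphic/Liu2021/AppendixC`, namespace `Literature.NumberTheory.Automorphic.Liu2021.AppendixC`.  THEOREMS ONLY (no
definition, no named fact, no instance, no `sorry`).  Cell `hodgecm-mathlib` (D-0151), FLOOR 0, programme F0P5a (D9op road 2′, crux item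
stmt-HodgeConjecture-24832): generic part of **C1** («the honest correspondence on points, characteristic 0») of the L3a pole census
`F0/P5a/L3a-POLE-census.v0.1.F0P5a-p02g0.md` / BRIEFS p04 row — the pointwise reading, on GEOMETRIC points of `∇X`, of the endomorphism
`𝒯 := t ≫ Σ_α Alb(T_{r α})` of the pole letter (`RecordCurveEichlerShimuraHonest` / `…Pointwise`, `Cruxes/HLiu418/Lines/F0_D9opRoad2.lean` ed. 2/3).

Everything is the printed identity `α_Y ≫ Alb_u = ∇u ≫ α_X` ([Liu2021] Def. 2.3; ★ `Albanese.α_map`) read on `K̄`-points (★ `AlgPoints`,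
★ `AbelianVariety.Hom.geomPointsMap`), plus additivity of `f ↦ f(P)` (★ `geomPointsMapAddMonoidHom`):

* `Albanese.geomPointsMap_map_α` — `Alb_u (α_Y(z)) = α_X(∇u z)` for a geometric point `z` of `∇Y`;
* `Albanese.geomPointsMap_sum_map_α` — `(Σ_i Alb_{u i})(α_Y(z)) = Σ_i α_X(∇(u i) z)`;
* `Albanese.geomPointsMap_trace_α` — **Lang's trace on points**: if `Alb_p ≫ t = Σ_g Alb_{act g}` (the Albanese trace of a finite quotient
  `p : X → Y`, [Lang1983AbelianVarieties] VIII §6 Thm. 13, ★ `Albanese.exists_trace_of_isSepQuotient`) then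
  `t(α_Y(∇p z)) = Σ_g α_X(∇(act g) z)` for every geometric point `z` of `∇X`;
* `Sec42Data.HeckeTranslates.geomPointsMap_albTr_α`, `…geomPointsMap_finsum_albTr_α` — the same for the Hecke translates `Alb(T_g)` of a §4.2
  datum (★ `albTr`, `α_albTr`): `Alb(T_g)(α_K(z)) = α_{K'}(∇T_g z)` and, for a family `γ : ι → 𝔾(𝔸_F^∞)` over a FINITE index type,
  `(∑ᶠ i, Alb(T_{γ i}))(α_K(z)) = ∑ᶠ i, α_{K'}(∇T_{γ i} z)`;
* `Sec42Data.HeckeTranslates.geomPointsMap_trace_finsum_albTr_α` — **C1, generic form**: with `t : A_K ⟶ A_N` satisfying the trace identity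
  `Alb_u ≫ t = Σ_g Alb_{act g}` for the transition `u : X_N → X_K` and a finite group action on `X_N`,
  `(t ≫ ∑ᶠ i, Alb(T_{γ i}))(α_K(∇u z)) = Σ_g ∑ᶠ i, α_K(∇T_{γ i} (∇(act g) z))` for every geometric point `z` of `∇X_N` — the honest Hecke
  correspondence of the pole letter evaluated on difference points.

HC_CM is proved only modulo the 7 printed citations until rung 0 closes; this file is a generic leaf and changes no count.

## References
* [Liu2021] Y. Liu, *Fourier–Jacobi cycles and arithmetic relative trace formula*, Camb. J. Math. 9 (2021), Def. 2.1 (1), Def. 2.3 (FJcycle.tex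
  l. 1174–1208), §4.2 l. 2066–2074, App. D proof of Cor. D.9 (p. 139).
* [Lang1983AbelianVarieties] S. Lang, *Abelian Varieties* (1959/1983), Ch. VIII §6 Thm. 13 (pp. 224–227).
* [MumfordAV1970] D. Mumford, *Abelian Varieties* (1970), §4 (points), §19 (homomorphisms are additive on points).
-/

set_option autoImplicit false

noncomputable section

open CategoryTheory AlgebraicGeometry MonoidalCategory NumberField
open scoped MonObj BigOperators
open Literature.AlgebraicGeometry.Motives (SchemeOver AbelianVariety AlgPoints)
open Literature.AlgebraicGeometry.Motives.AbelianVariety (Hom.geomPointsMap Hom.geomPointsMap_ofMul Hom.geomPointsMap_comp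
  Hom.geomPointsMapAddMonoidHom Hom.geomPointsMapAddMonoidHom_apply)

namespace Literature.NumberTheory.Automorphic.Liu2021.AppendixC

universe u

/-! ## §1 Albanese functoriality on geometric difference points -/

namespace Albanese

variable {k : Type u} [Field k] {X Y : SchemeOver k}

/-- **`Alb_u (α_Y(z)) = α_X(∇u z)`** for a geometric point `z` of `∇Y` — the printed identity `α_Y ≫ Alb_u = ∇u ≫ α_X` ([Liu2021] Def. 2.3)
read on `k̄`-points. [cite: Liu2021, Def. 2.3 (FJcycle.tex l. 1202–1208)] -/
theorem geomPointsMap_map_α (aY : Albanese Y) (aX : Albanese X) (u : Y ⟶ X) (z : AlgPoints aY.nabla.N (AlgebraicClosure k)) :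
    Hom.geomPointsMap (aY.map aX u) (Additive.ofMul (AlgPoints.map aY.α z)) =
      Additive.ofMul (AlgPoints.map aX.α (AlgPoints.map (aY.nabla.map aX.nabla u) z)) := by
  rw [Hom.geomPointsMap_ofMul, ← AlgPoints.map_comp_apply, aY.α_map aX u, AlgPoints.map_comp_apply]

/-- **`(Σ_i Alb_{u i})(α_Y(z)) = Σ_i α_X(∇(u i) z)`** (finite sums; homomorphisms act additively on points, [MumfordAV1970] §19).
[cite: Liu2021, Def. 2.3 (FJcycle.tex l. 1202–1208)] [cite: MumfordAV1970, §19 (p. 173)] -/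
theorem geomPointsMap_sum_map_α {J : Type*} (s : Finset J) (aY : Albanese Y) (aX : Albanese X) (u : J → (Y ⟶ X))
    (z : AlgPoints aY.nabla.N (AlgebraicClosure k)) :
    Hom.geomPointsMap (∑ i ∈ s, aY.map aX (u i)) (Additive.ofMul (AlgPoints.map aY.α z)) =
      ∑ i ∈ s, Additive.ofMul (AlgPoints.map aX.α (AlgPoints.map (aY.nabla.map aX.nabla (u i)) z)) := by
  rw [← Hom.geomPointsMapAddMonoidHom_apply, map_sum, AddMonoidHom.finsetSum_apply]
  refine Finset.sum_congr rfl fun i _ => ?_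
  rw [Hom.geomPointsMapAddMonoidHom_apply, geomPointsMap_map_α]

/-- **Lang's trace on difference points.**  If `t : Alb_Y ⟶ Alb_X` satisfies the trace identity `Alb_p ≫ t = Σ_g Alb_{act g}` for a morphism
`p : X ⟶ Y` and a family of endomorphisms `act g` of `X` ([Lang1983AbelianVarieties] VIII §6 Thm. 13; ★ `Albanese.exists_trace_of_isSepQuotient`),
then for every geometric point `z` of `∇X`: `t(α_Y(∇p z)) = Σ_g α_X(∇(act g) z)`.
[cite: Lang1983AbelianVarieties, Ch. VIII §6 Thm. 13 (pp. 224–227)] [cite: Liu2021, Def. 2.3 (FJcycle.tex l. 1202–1208)] -/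
theorem geomPointsMap_trace_α {Δ : Type*} (s : Finset Δ) (aX : Albanese X) (aY : Albanese Y) (p : X ⟶ Y) (act : Δ → (X ⟶ X))
    (t : aY.Alb ⟶ aX.Alb) (ht : aX.map aY p ≫ t = ∑ g ∈ s, aX.map aX (act g))
    (z : AlgPoints aX.nabla.N (AlgebraicClosure k)) :
    Hom.geomPointsMap t (Additive.ofMul (AlgPoints.map aY.α (AlgPoints.map (aX.nabla.map aY.nabla p) z))) =
      ∑ g ∈ s, Additive.ofMul (AlgPoints.map aX.α (AlgPoints.map (aX.nabla.map aX.nabla (act g)) z)) := by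
  rw [← geomPointsMap_map_α aX aY p z, ← AddMonoidHom.comp_apply, ← Hom.geomPointsMap_comp, ht,
    geomPointsMap_sum_map_α]

end Albanese

/-! ## §2 Hecke translates of a §4.2 datum on geometric difference points -/

namespace Sec42Data.HeckeTranslates

variable {F E : Type} [Field F] [NumberField F] [IsTotallyReal F] [Field E] [NumberField E] [Algebra F E]
  [IsTotallyComplex E] [Algebra.IsQuadraticExtension F E]
variable {P5 : PropC5Data F E} {isotropicAt : ℕ → Prop} {C : Sec42Data P5 isotropicAt} (T : C.HeckeTranslates)

/-- **`Alb(T_g)(α_K(z)) = α_{K'}(∇T_g z)`** for a geometric point `z` of `∇X_K` (★ `α_albTr` on points).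
[cite: Liu2021, Def. 2.3 (FJcycle.tex l. 1206–1208) and §4.2 l. 2074] -/
theorem geomPointsMap_albTr_α (g : C.G) (K K' : C5.SmallLevel C.S.K₀) (h : C5.HeckeLE g K K')
    (z : AlgPoints (C.alb K).nabla.N (AlgebraicClosure E)) :
    Hom.geomPointsMap (T.albTr g K K' h) (Additive.ofMul (AlgPoints.map (C.alb K).α z)) =
      Additive.ofMul (AlgPoints.map (C.alb K').α (AlgPoints.map ((C.alb K).nabla.map (C.alb K').nabla (T.tr g K K' h)) z)) :=
  Albanese.geomPointsMap_map_α _ _ _ z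

/-- **`(∑ᶠ i, Alb(T_{γ i}))(α_K(z)) = ∑ᶠ i, α_{K'}(∇T_{γ i} z)`** over a FINITE index type (e.g. the cosets `α ∈ K tw K / K` of the pole letter, ★
`finite_orbit_of_isCompact_isOpen`). [cite: Liu2021, §4.2 l. 2074 and App. D proof of Cor. D.9 (p. 139)] -/
theorem geomPointsMap_finsum_albTr_α {J : Type*} [Finite J] (gs : J → C.G) (K K' : C5.SmallLevel C.S.K₀)
    (h : ∀ i, C5.HeckeLE (gs i) K K') (z : AlgPoints (C.alb K).nabla.N (AlgebraicClosure E)) :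
    Hom.geomPointsMap (∑ᶠ i, T.albTr (gs i) K K' (h i)) (Additive.ofMul (AlgPoints.map (C.alb K).α z)) =
      ∑ᶠ i, Additive.ofMul (AlgPoints.map (C.alb K').α (AlgPoints.map ((C.alb K).nabla.map (C.alb K').nabla (T.tr (gs i) K K' (h i))) z)) := by
  haveI := Fintype.ofFinite J
  rw [finsum_eq_sum_of_fintype, finsum_eq_sum_of_fintype]
  exact Albanese.geomPointsMap_sum_map_α Finset.univ _ _ _ z

/-- **C1, generic form — the trace-scaled honest Hecke correspondence on difference points.**  Let `N, K` be small levels with a transition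
`u : X_N ⟶ X_K` (any `E`-morphism, e.g. `C.cpt.X.map (homOfLE hNK)`), `act g` a finite family of endomorphisms of `X_N` (e.g. the level-quotient
action, u4), `t : A_K ⟶ A_N` with the trace identity `Alb_u ≫ t = Σ_g Alb_{act g}` ([Lang1983AbelianVarieties] VIII §6 Thm. 13 / ★ p769538
`albaneseTraceOfFiniteQuotient_holds`), and `γ : ι → 𝔾(𝔸_F^∞)` a finite family with the translates `T_{γ i} : X_N → X_K` defined.  Then for every
geometric point `z` of `∇X_N`:
`(t ≫ ∑ᶠ i, Alb(T_{γ i}))(α_K(∇u z)) = Σ_g ∑ᶠ i, α_K(∇T_{γ i}(∇(act g) z))` — [Liu2021] p. 139 «on `T_K`» in characteristic `0`, before reduction.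
[cite: Liu2021, §4.2 l. 2066–2074 and App. D proof of Cor. D.9 (p. 139)] [cite: Lang1983AbelianVarieties, Ch. VIII §6 Thm. 13 (pp. 224–227)] -/
theorem geomPointsMap_trace_finsum_albTr_α {Δ J : Type*} [Finite J] (s : Finset Δ) {N K : C5.SmallLevel C.S.K₀}
    (u : C.X N ⟶ C.X K) (act : Δ → (C.X N ⟶ C.X N)) (t : C.A K ⟶ C.A N)
    (ht : (C.alb N).map (C.alb K) u ≫ t = ∑ g ∈ s, (C.alb N).map (C.alb N) (act g))
    (gs : J → C.G) (h : ∀ i, C5.HeckeLE (gs i) N K) (z : AlgPoints (C.alb N).nabla.N (AlgebraicClosure E)) :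
    Hom.geomPointsMap (t ≫ ∑ᶠ i, T.albTr (gs i) N K (h i))
        (Additive.ofMul (AlgPoints.map (C.alb K).α (AlgPoints.map ((C.alb N).nabla.map (C.alb K).nabla u) z))) =
      ∑ g ∈ s, ∑ᶠ i, Additive.ofMul (AlgPoints.map (C.alb K).α
        (AlgPoints.map ((C.alb N).nabla.map (C.alb K).nabla (T.tr (gs i) N K (h i)))
          (AlgPoints.map ((C.alb N).nabla.map (C.alb N).nabla (act g)) z))) := by
  rw [Hom.geomPointsMap_comp, AddMonoidHom.comp_apply, Albanese.geomPointsMap_trace_α s _ _ u act t ht z]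
  erw [map_sum (Hom.geomPointsMap (∑ᶠ i, T.albTr (gs i) N K (h i)))]
  refine Finset.sum_congr rfl fun g _ => ?_
  exact T.geomPointsMap_finsum_albTr_α gs N K h _

end Sec42Data.HeckeTranslates

end Literature.NumberTheory.Automorphic.Liu2021.AppendixC

end
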